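import Literature.NumberTheory.LFunctions.LiouvilleOneSided
import Literature.NumberTheory.LFunctions.MertensConjectureOneSidedZeros
import Literature.NumberTheory.LFunctions.ZetaRealAxis
import HarnessLib

/-!
# Eventually `L(x) ≤ 0` forces the zeros of `ζ` to be simple (Pólya–Ingham)

Topic `Literature/NumberTheory/LFunctions`. Borwein–Ferguson–Mossinghoff 2008, §1 (p. 1681), after
Pólya's criterion: "It is also known that the zeros of the zeta function are all simple if `L(n)` is
eventually of constant sign"; (p. 1682): "In 1942, Ingham noted that the Riemann hypothesis, and the
simplicity of the zeros of `ζ(s)` follow more generally if either `L(n) < c√n` or `L(n) > −c√n`".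
This file proves the simplicity clause in the case "eventually `L(x) ≤ 0`" (the case "eventually
`L(x) ≥ 0`" is void: `L(x) < 0` for arbitrarily large `x`, `LiouvilleOneSidedRH.lean`), by the
argument Titchmarsh prints for `M(x)` (proof of Thm. 14.29 (A), p. 276; Odlyzko–te Riele (2.2)),
transported to `L` — the Liouville analogue of `zetaZeros_simple_onLine_of_oneSided`
(`MertensConjectureOneSidedZeros.lean`):

* `norm_mellin_liouville_le_of_eventually_nonpos` — if `L(x) ≤ 0` for `x ≥ x₁` then, for
  `½ < Re s ≤ ¾`, `‖∫_1^∞ L(x) x^{-s-1} dx‖ ≤ 1/(Re s − ½) + (2 + 4·max(x₁,1))`: the integral is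
  dominated by `∫_1^∞ |L| x^{-σ-1} = −∫_1^∞ L x^{-σ-1} + O(1) = −ζ(2σ)/(σζ(σ)) + O(1)`
  (`mellin_liouville_eq_of_integrable`), and `ζ(2σ) ≤ 1 + 1/(2σ−1)`, `ζ(σ) ≤ σ/(σ−1) ≤ −1` on
  `(½, ¾]` (Titchmarsh (2.1.4) on the real axis, `ZetaRealAxis.lean`).
* `zetaZeros_simple_onLine_of_liouvilleSum_eventually_nonpos` — every zero `ρ` of `ζ` with
  `0 < Re ρ < 1` has `Re ρ = ½` (Landau, `riemannZeta_ne_zero_of_liouville_integrable`, and the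
  functional equation) and `ζ'(ρ) ≠ 0`: at `s = ρ + u`,
  `ζ(2s) = (∫_1^∞ L x^{-s-1}) · s ζ(s)` (`mellin_liouville_mul_eq`) would be
  `O((1/u)·u²) → 0` for a double zero, while `ζ(2s) → ζ(2ρ) = ζ(1 + 2iγ) ≠ 0`.
* `simpleZeros_of_liouvilleSum_eventually_nonpos` — packaged with the tree's
  `SimpleZerosConjecture` (`RHWave0.lean`).

## References

* [BorweinFergusonMossinghoff2008] P. Borwein, R. Ferguson, M. J. Mossinghoff, Sign changes in sums
  of the Liouville function, Math. Comp. 77 (2008), 1681–1694: §1, pp. 1681–1682.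
* [Titchmarsh1986] E. C. Titchmarsh, The Theory of the Riemann Zeta-Function, 2nd ed.: §14.29
  (proof of Thm. 14.29 (A), eq. (14.29.2)); §2.1 (2.1.4); §2.12.
* [OdlyzkoTeRiele1985] A. M. Odlyzko, H. J. J. te Riele, Disproof of the Mertens conjecture,
  J. reine angew. Math. 357 (1985): §2 (2.2), p. 141 (the template for `M`).
-/

noncomputable section

open Complex Filter Asymptotics MeasureTheory Set
open scoped Real Topology

namespace Literature.NumberTheory.LFunctions

/-- Landau's theorem for "eventually `L(x) ≤ 0`": `∫_1^∞ |L(x)| x^{-σ-1} dx < ∞` for every `σ > ½`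
(the case `η = 1`, `A = 0` of `integrableOn_liouville_rpow_of_oneSided`).
[cite: BorweinFergusonMossinghoff2008, §1 (p. 1681)] -/
theorem integrableOn_liouville_rpow_of_eventually_nonpos {x₁ : ℝ}
    (hL : ∀ x, x₁ ≤ x → liouvilleSum x ≤ 0) {σ : ℝ} (hσ : 1 / 2 < σ) :
    IntegrableOn (fun x ↦ (liouvilleSum x : ℝ) * x ^ (-(σ + 1))) (Ioi 1) := by
  refine integrableOn_liouville_rpow_of_oneSided (A := 0) (η := 1) (x₁ := x₁) (Or.inl rfl)
    (fun x hx ↦ ?_) hσ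
  have : (liouvilleSum x : ℝ) ≤ 0 := by exact_mod_cast hL x hx
  simpa using this

/-- **The bound at the abscissa** (Titchmarsh (14.29.2) transported to `L`): if `L(x) ≤ 0` for
`x ≥ x₁`, then for `½ < Re s ≤ ¾`,
`‖∫_1^∞ L(x) x^{-s-1} dx‖ ≤ 1/(Re s − ½) + (2 + 4·max(x₁, 1))`. Indeed the norm is at most
`∫_1^∞ |L| x^{-σ-1} ≤ −∫_1^∞ L x^{-σ-1} + 2 max(x₁,1)/σ = −ζ(2σ)/(σζ(σ)) + 2max(x₁,1)/σ`, with
`ζ(2σ) ≤ 1 + 1/(2σ−1)` and `ζ(σ) ≤ σ/(σ−1) ≤ −1`.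
[cite: Titchmarsh1986, §14.29 (proof of Thm 14.29 (A), eq. (14.29.2))] [cite: Titchmarsh1986, §2.1 eq. (2.1.4)] -/
theorem norm_mellin_liouville_le_of_eventually_nonpos {x₁ : ℝ}
    (hL : ∀ x, x₁ ≤ x → liouvilleSum x ≤ 0) {s : ℂ} (hs1 : 1 / 2 < s.re) (hs2 : s.re ≤ 3 / 4) :
    ‖Landau.mellinIoi (fun x ↦ (liouvilleSum x : ℝ)) s‖ ≤
      1 / (s.re - 1 / 2) + (2 + 4 * max x₁ 1) := by
  set x₂ : ℝ := max x₁ 1 with hx₂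
  have hx₂1 : 1 ≤ x₂ := le_max_right _ _
  have hL₂ : ∀ x, x₂ ≤ x → liouvilleSum x ≤ 0 := fun x hx ↦ hL x ((le_max_left _ _).trans hx)
  have hI : ∀ σ : ℝ, 1 / 2 < σ →
      IntegrableOn (fun x ↦ (liouvilleSum x : ℝ) * x ^ (-(σ + 1))) (Ioi 1) :=
    fun σ hσ ↦ integrableOn_liouville_rpow_of_eventually_nonpos hL hσ
  set σ : ℝ := s.re with hσdef
  have hσ : 1 / 2 < σ := hs1
  have hσ34 : σ ≤ 3 / 4 := hs2
  have hσ0 : 0 < σ := by linarith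
  have hσ1 : σ < 1 := by linarith
  have hIσ := hI σ hσ
  -- (1) `‖F(s)‖ ≤ ∫ |L| x^{-σ-1}`
  have hnorm : ‖Landau.mellinIoi (fun x ↦ (liouvilleSum x : ℝ)) s‖ ≤
      ∫ x in Ioi (1 : ℝ), |(liouvilleSum x : ℝ)| * x ^ (-(σ + 1)) :=
    Landau.norm_mellinIoi_le (le_of_eq hσdef.symm) hIσ
  -- (2) `∫ |L| x^{-σ-1} ≤ -∫ L x^{-σ-1} + 2 x₂/σ`
  have hpow_int : IntegrableOn (fun x : ℝ ↦ x ^ (-(σ + 1))) (Ioi 1) :=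
    integrableOn_Ioi_rpow_of_lt (by linarith : -(σ + 1) < -1) zero_lt_one
  have habs_int : IntegrableOn (fun x ↦ |(liouvilleSum x : ℝ)| * x ^ (-(σ + 1))) (Ioi 1) := by
    refine hIσ.norm.congr ?_
    rw [Filter.EventuallyEq, ae_restrict_iff' measurableSet_Ioi]
    refine Eventually.of_forall fun x (hx : 1 < x) ↦ ?_
    have hx0 : 0 < x := zero_lt_one.trans hx
    rw [norm_mul, Real.norm_eq_abs, Real.norm_eq_abs, abs_of_pos (Real.rpow_pos_of_pos hx0 _)]
  have hmaj_int : IntegrableOn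
      (fun x ↦ -((liouvilleSum x : ℝ) * x ^ (-(σ + 1))) + 2 * x₂ * x ^ (-(σ + 1))) (Ioi 1) := by
    have hneg : IntegrableOn (fun x ↦ -((liouvilleSum x : ℝ) * x ^ (-(σ + 1)))) (Ioi 1) := hIσ.neg
    exact hneg.add (hpow_int.const_mul _)
  have hptw : ∀ x ∈ Ioi (1 : ℝ), |(liouvilleSum x : ℝ)| * x ^ (-(σ + 1)) ≤
      -((liouvilleSum x : ℝ) * x ^ (-(σ + 1))) + 2 * x₂ * x ^ (-(σ + 1)) := by
    intro x hx
    have hx1 : 1 < x := hx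
    have hx0 : 0 < x := by linarith
    have hpow : 0 < x ^ (-(σ + 1)) := Real.rpow_pos_of_pos hx0 _
    rcases le_or_gt x₂ x with h | h
    · have hLx : (liouvilleSum x : ℝ) ≤ 0 := by exact_mod_cast hL₂ x h
      rw [abs_of_nonpos hLx]
      have : 0 ≤ 2 * x₂ * x ^ (-(σ + 1)) := by positivity
      linarith
    · have hLx : |(liouvilleSum x : ℝ)| ≤ x₂ := (abs_liouvilleSum_le hx0.le).trans h.le
      have h1 : |(liouvilleSum x : ℝ)| * x ^ (-(σ + 1)) ≤ x₂ * x ^ (-(σ + 1)) :=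
        mul_le_mul_of_nonneg_right hLx hpow.le
      have h2 : (liouvilleSum x : ℝ) * x ^ (-(σ + 1)) ≤ x₂ * x ^ (-(σ + 1)) :=
        (mul_le_mul_of_nonneg_right (le_abs_self _) hpow.le).trans h1
      linarith
  have hstep2 : (∫ x in Ioi (1 : ℝ), |(liouvilleSum x : ℝ)| * x ^ (-(σ + 1))) ≤
      -(∫ x in Ioi (1 : ℝ), (liouvilleSum x : ℝ) * x ^ (-(σ + 1))) + 2 * x₂ / σ := by
    have h := setIntegral_mono_on habs_int hmaj_int measurableSet_Ioi hptw
    have hneg : Integrable (fun x ↦ -((liouvilleSum x : ℝ) * x ^ (-(σ + 1))))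
        (volume.restrict (Ioi 1)) := hIσ.neg
    have hcm : Integrable (fun x : ℝ ↦ 2 * x₂ * x ^ (-(σ + 1))) (volume.restrict (Ioi 1)) :=
      hpow_int.const_mul _
    rw [integral_add hneg hcm, integral_neg, integral_const_mul,
      integral_Ioi_rpow_of_lt (by linarith) zero_lt_one, Real.one_rpow] at h
    have hσeq : -(σ + 1) + 1 = -σ := by ring
    rw [hσeq] at h
    have : 2 * x₂ * (-1 / -σ) = 2 * x₂ / σ := by
      rw [neg_div_neg_eq]
      field_simp
    linarith [h, this]
  -- (3) the real integral is `ζ(2σ)/(σζ(σ))`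
  have hσ1' : (σ : ℂ) ≠ 1 := by exact_mod_cast hσ1.ne
  have hmel := mellin_liouville_eq_of_integrable hI (s := (σ : ℂ)) (by simpa using hσ) hσ1'
  have hreal : (((∫ x in Ioi (1 : ℝ), (liouvilleSum x : ℝ) * x ^ (-(σ + 1)) : ℝ)) : ℂ) =
      riemannZeta (2 * σ) / ((σ : ℂ) * riemannZeta σ) := by
    rw [← hmel, ← Landau.mellinIoiLog_zero, Landau.mellinIoiLog_ofReal]
    simp
  -- real forms of `ζ(σ)`, `ζ(2σ)` and their sizes
  set F1 : ℝ := ∫ x in Ioi (1 : ℝ), Int.fract x * x ^ (-(σ + 1)) with hF1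
  set F2 : ℝ := ∫ x in Ioi (1 : ℝ), Int.fract x * x ^ (-(2 * σ + 1)) with hF2
  have hζσ : riemannZeta σ = ((σ / (σ - 1) - σ * F1 : ℝ) : ℂ) :=
    riemannZeta_ofReal_eq_of_pos hσ0 hσ1.ne
  have hζ2σ : riemannZeta (2 * σ) = (((2 * σ) / (2 * σ - 1) - (2 * σ) * F2 : ℝ) : ℂ) := by
    have := riemannZeta_ofReal_eq_of_pos (σ := 2 * σ) (by linarith) (by linarith)
    push_cast at this ⊢
    exact this
  set z1 : ℝ := σ / (σ - 1) - σ * F1 with hz1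
  set z2 : ℝ := (2 * σ) / (2 * σ - 1) - (2 * σ) * F2 with hz2
  have hF10 : 0 ≤ F1 := fractIntegralReal_nonneg σ
  have hF20 : 0 ≤ F2 := fractIntegralReal_nonneg (2 * σ)
  have hz1_le : z1 ≤ -1 := by
    have h1 : σ / (σ - 1) ≤ -1 := by
      rw [div_le_iff_of_neg (by linarith), neg_one_mul, neg_sub]
      linarith
    have h2 : 0 ≤ σ * F1 := mul_nonneg hσ0.le hF10
    rw [hz1]
    linarith
  have hz1_neg : z1 < 0 := by linarith
  have h2σ1 : 0 < 2 * σ - 1 := by linarith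
  have hz2_le : z2 ≤ 1 + 1 / (2 * σ - 1) := by
    have h1 : (2 * σ) / (2 * σ - 1) = 1 + 1 / (2 * σ - 1) := by
      field_simp
      ring
    have h2 : 0 ≤ (2 * σ) * F2 := mul_nonneg (by linarith) hF20
    rw [hz2]
    linarith
  -- the real identity `I = z2/(σ z1)`
  have hIeq : (∫ x in Ioi (1 : ℝ), (liouvilleSum x : ℝ) * x ^ (-(σ + 1))) = z2 / (σ * z1) := by
    have h := hreal
    rw [hζσ, hζ2σ] at h
    have h' : (((∫ x in Ioi (1 : ℝ), (liouvilleSum x : ℝ) * x ^ (-(σ + 1)) : ℝ)) : ℂ) =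
        ((z2 / (σ * z1) : ℝ) : ℂ) := by
      rw [h]; push_cast; ring
    exact Complex.ofReal_injective h'
  -- `-(z2/(σ z1)) ≤ 2 + 1/(σ - ½)`
  have hσz1 : σ * z1 < 0 := mul_neg_of_pos_of_neg hσ0 hz1_neg
  have hnegI : -(z2 / (σ * z1)) ≤ 2 + 1 / (σ - 1 / 2) := by
    rw [← div_neg, neg_mul_eq_mul_neg]
    -- `z2 / (σ * (-z1))` with `σ * (-z1) ≥ 1/2`
    have hden : 1 / 2 ≤ σ * -z1 := by nlinarith
    have hden0 : 0 < σ * -z1 := by linarith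
    rcases le_or_gt z2 0 with hz | hz
    · have : z2 / (σ * -z1) ≤ 0 := div_nonpos_of_nonpos_of_nonneg hz hden0.le
      have : 0 < 1 / (σ - 1 / 2) := by positivity
      linarith
    · calc z2 / (σ * -z1) ≤ z2 / (1 / 2) := div_le_div_of_nonneg_left hz.le (by norm_num) hden
        _ = 2 * z2 := by ring
        _ ≤ 2 * (1 + 1 / (2 * σ - 1)) := by linarith
        _ = 2 + 1 / (σ - 1 / 2) := by
            have : 1 / (2 * σ - 1) = (1 / 2) * (1 / (σ - 1 / 2)) := by
              rw [one_div_mul_one_div]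
              congr 1
              ring
            rw [this]
            ring
  -- (4) assemble
  have h2x : 2 * x₂ / σ ≤ 4 * x₂ := by
    rw [div_le_iff₀ hσ0]
    nlinarith
  calc ‖Landau.mellinIoi (fun x ↦ (liouvilleSum x : ℝ)) s‖
      ≤ ∫ x in Ioi (1 : ℝ), |(liouvilleSum x : ℝ)| * x ^ (-(σ + 1)) := hnorm
    _ ≤ -(∫ x in Ioi (1 : ℝ), (liouvilleSum x : ℝ) * x ^ (-(σ + 1))) + 2 * x₂ / σ := hstep2
    _ = -(z2 / (σ * z1)) + 2 * x₂ / σ := by rw [hIeq]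
    _ ≤ (2 + 1 / (σ - 1 / 2)) + 4 * x₂ := add_le_add hnegI h2x
    _ = 1 / (σ - 1 / 2) + (2 + 4 * x₂) := by ring

/-- **Eventually `L(x) ≤ 0` ⟹ every zero of `ζ` in the critical strip lies on the line and is
simple** ("the zeros of the zeta function are all simple if `L(n)` is eventually of constant sign",
BFM 2008 §1 p. 1681; Ingham 1942, p. 1682), by Titchmarsh's argument for Thm. 14.29 (A): RH from
Landau's theorem (`riemannZeta_ne_zero_of_liouville_integrable` and the functional equation); and if
`ζ'(ρ) = 0`, then at `s = ρ + u` the identity `ζ(2s) = (∫_1^∞ L x^{-s-1} dx)·sζ(s)`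
(`mellin_liouville_mul_eq`) and `‖∫_1^∞ L x^{-s-1} dx‖ ≤ 1/u + O(1)`
(`norm_mellin_liouville_le_of_eventually_nonpos`) give `ζ(2s) = O(u) → 0`, contradicting
`ζ(2s) → ζ(2ρ) = ζ(1 + 2iγ) ≠ 0`. [cite: BorweinFergusonMossinghoff2008, §1 (pp. 1681–1682)]
[cite: Titchmarsh1986, §14.29 (proof of Thm 14.29 (A))] -/
theorem zetaZeros_simple_onLine_of_liouvilleSum_eventually_nonpos {x₁ : ℝ}
    (hL : ∀ x, x₁ ≤ x → liouvilleSum x ≤ 0) :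
    ∀ ρ : ℂ, riemannZeta ρ = 0 → 0 < ρ.re → ρ.re < 1 →
      ρ.re = 1 / 2 ∧ deriv riemannZeta ρ ≠ 0 := by
  have hI : ∀ σ : ℝ, 1 / 2 < σ →
      IntegrableOn (fun x ↦ (liouvilleSum x : ℝ) * x ^ (-(σ + 1))) (Ioi 1) :=
    fun σ hσ ↦ integrableOn_liouville_rpow_of_eventually_nonpos hL hσ
  have hright : ∀ s : ℂ, 1 / 2 < s.re → riemannZeta s ≠ 0 :=
    fun s hs ↦ riemannZeta_ne_zero_of_liouville_integrable hI hs
  intro ρ hζ h0 h1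
  -- (a) `Re ρ = ½`
  have hre : ρ.re = 1 / 2 := by
    rcases lt_trichotomy ρ.re (1 / 2) with h | h | h
    · exfalso
      have hρn : ∀ n : ℕ, ρ ≠ -n := by
        intro n hn
        have := congrArg Complex.re hn
        simp at this
        linarith
      have hρ1 : ρ ≠ 1 := by
        intro h1'
        rw [h1'] at h1
        simp at h1
      have h1ρ : riemannZeta (1 - ρ) = 0 := by
        rw [riemannZeta_one_sub hρn hρ1, hζ, mul_zero]
      exact hright (1 - ρ) (by simp; linarith) h1ρ
    · exact h
    · exact absurd hζ (hright ρ h)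
  refine ⟨hre, fun hd ↦ ?_⟩
  -- (b) the double zero and the non-vanishing of `ζ(2ρ)`
  have hρ1 : ρ ≠ 1 := by
    intro h
    rw [h] at h1
    simp at h1
  obtain ⟨C, δ, hδ, hC⟩ := norm_riemannZeta_le_sq_of_deriv_eq_zero hρ1 hζ hd
  set C₁ : ℝ := max C 1 with hC₁
  have hC₁0 : 0 < C₁ := lt_of_lt_of_le one_pos (le_max_right _ _)
  have hC' : ∀ z : ℂ, ‖z - ρ‖ < δ → ‖riemannZeta z‖ ≤ C₁ * ‖z - ρ‖ ^ 2 := fun z hz ↦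
    (hC z hz).trans (mul_le_mul_of_nonneg_right (le_max_left _ _) (by positivity))
  have h2ρre : (2 * ρ).re = 1 := by simp [hre]
  have hζ2ρ : riemannZeta (2 * ρ) ≠ 0 := riemannZeta_ne_zero_of_one_le_re (by rw [h2ρre])
  have h2ρ1 : 2 * ρ ≠ 1 := by
    intro h
    have hρhalf : ρ = ((1 / 2 : ℝ) : ℂ) := by
      have : ρ = (1 / 2 : ℂ) := by linear_combination (1 / 2 : ℂ) * h
      rw [this]; push_cast; ring
    exact riemannZeta_ofReal_ne_zero_of_pos_of_lt_one (1 / 2) (by norm_num) (by norm_num)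
      (hρhalf ▸ hζ)
  -- continuity of `ζ` at `2ρ`: `‖ζ(w)‖ > ε` for `‖w - 2ρ‖ < δ₂`, `ε = ‖ζ(2ρ)‖/2`
  set ε : ℝ := ‖riemannZeta (2 * ρ)‖ / 2 with hε
  have hε0 : 0 < ε := by rw [hε]; exact half_pos (norm_pos_iff.2 hζ2ρ)
  have hcont : ContinuousAt riemannZeta (2 * ρ) := (differentiableAt_riemannZeta h2ρ1).continuousAt
  obtain ⟨δ₂, hδ₂, hδ₂b⟩ := Metric.continuousAt_iff.1 hcont ε hε0
  have hlow : ∀ w : ℂ, ‖w - 2 * ρ‖ < δ₂ → ε < ‖riemannZeta w‖ := by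
    intro w hw
    have h := hδ₂b (by rwa [dist_eq_norm])
    rw [dist_eq_norm] at h
    have := norm_sub_norm_le (riemannZeta (2 * ρ)) (riemannZeta w)
    rw [norm_sub_rev] at h
    rw [hε] at h ⊢
    linarith
  -- constants
  set B : ℝ := 2 + 4 * max x₁ 1 with hB
  have hB0 : 0 < B := by positivity
  set Kρ : ℝ := ‖ρ‖ + 1 with hKρ
  have hKρ0 : 0 < Kρ := by positivity
  set M : ℝ := Kρ * C₁ * (1 + B) + 1 with hM
  have hM0 : 0 < M := by positivity
  -- the abscissa offset `u`
  set u : ℝ := min (δ / 2) (min (δ₂ / 4) (min (1 / 4) (ε / (2 * M)))) with hu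
  have hu0 : 0 < u := lt_min (by positivity) (lt_min (by positivity) (lt_min (by norm_num)
    (by positivity)))
  have huδ : u < δ := (min_le_left _ _).trans_lt (by linarith)
  have huδ₂ : u ≤ δ₂ / 4 := (min_le_right _ _).trans (min_le_left _ _)
  have hu4 : u ≤ 1 / 4 := ((min_le_right _ _).trans (min_le_right _ _)).trans (min_le_left _ _)
  have huε : u ≤ ε / (2 * M) := ((min_le_right _ _).trans (min_le_right _ _)).trans (min_le_right _ _)
  set s : ℂ := ρ + (u : ℂ) with hs
  have hsρ : s - ρ = (u : ℂ) := by rw [hs, add_sub_cancel_left]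
  have hsre : s.re = 1 / 2 + u := by rw [hs, Complex.add_re, hre, Complex.ofReal_re]
  have hs1 : 1 / 2 < s.re := by rw [hsre]; linarith
  have hs34 : s.re ≤ 3 / 4 := by rw [hsre]; linarith
  have hsne1 : s ≠ 1 := by
    intro h
    have := congrArg Complex.re h
    rw [hsre, Complex.one_re] at this
    linarith
  -- the identity `F(s) · s ζ(s) = ζ(2s)` and the three bounds
  have hid := mellin_liouville_mul_eq hI hs1 hsne1
  have hF := norm_mellin_liouville_le_of_eventually_nonpos hL hs1 hs34
  rw [hsre, show 1 / 2 + u - 1 / 2 = u by ring, ← hB] at hF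
  have hzs : ‖riemannZeta s‖ ≤ C₁ * u ^ 2 := by
    have hn : ‖s - ρ‖ = u := by rw [hsρ, Complex.norm_real, Real.norm_eq_abs, abs_of_pos hu0]
    have := hC' s (by rw [hn]; exact huδ)
    rwa [hn] at this
  have hsn : ‖s‖ ≤ Kρ := by
    rw [hs, hKρ]
    refine (norm_add_le _ _).trans ?_
    rw [Complex.norm_real, Real.norm_eq_abs, abs_of_pos hu0]
    linarith
  -- upper bound: `‖ζ(2s)‖ ≤ (1/u + B) Kρ C₁ u² ≤ M u ≤ ε/2`
  have hupper : ‖riemannZeta (2 * s)‖ ≤ ε / 2 := by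
    have h1 : ‖riemannZeta (2 * s)‖ ≤ (1 / u + B) * (Kρ * (C₁ * u ^ 2)) := by
      rw [← hid, norm_mul, norm_mul]
      have hF0 : 0 ≤ 1 / u + B := by positivity
      exact mul_le_mul hF (mul_le_mul hsn hzs (norm_nonneg _) hKρ0.le) (by positivity) hF0
    have h2 : (1 / u + B) * (Kρ * (C₁ * u ^ 2)) = Kρ * C₁ * (u + B * u ^ 2) := by
      calc (1 / u + B) * (Kρ * (C₁ * u ^ 2)) = Kρ * C₁ * ((1 / u) * u ^ 2 + B * u ^ 2) := by ring
        _ = Kρ * C₁ * (u + B * u ^ 2) := by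
            rw [pow_two, ← mul_assoc, one_div_mul_cancel hu0.ne', one_mul]
    have h3 : u + B * u ^ 2 ≤ (1 + B) * u := by
      have : u ^ 2 ≤ u := by nlinarith
      nlinarith
    have h4 : Kρ * C₁ * (u + B * u ^ 2) ≤ M * u := by
      have hKC : 0 ≤ Kρ * C₁ := by positivity
      calc Kρ * C₁ * (u + B * u ^ 2) ≤ Kρ * C₁ * ((1 + B) * u) :=
            mul_le_mul_of_nonneg_left h3 hKC
        _ = (Kρ * C₁ * (1 + B)) * u := by ring
        _ ≤ M * u := mul_le_mul_of_nonneg_right (by rw [hM]; linarith) hu0.le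
    have h5 : M * u ≤ ε / 2 :=
      calc M * u ≤ M * (ε / (2 * M)) := mul_le_mul_of_nonneg_left huε hM0.le
        _ = ε / 2 := by field_simp
    linarith
  -- lower bound: `‖2s - 2ρ‖ = 2u < δ₂`
  have hlower : ε < ‖riemannZeta (2 * s)‖ := by
    refine hlow (2 * s) ?_
    rw [show 2 * s - 2 * ρ = 2 * (s - ρ) by ring, hsρ, norm_mul, Complex.norm_ofNat,
      Complex.norm_real, Real.norm_eq_abs, abs_of_pos hu0]
    linarith
  linarith

/-- Packaged with the tree's `SimpleZerosConjecture` (`∀ ρ ∈ riemannZetaNontrivialZeros, ζ'(ρ) ≠ 0`,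
`RHWave0.lean`): **if `L(x) ≤ 0` for all large `x`, all non-trivial zeros of `ζ` are simple**
(BFM 2008 §1 p. 1681). Non-trivial zeros lie in `0 < Re s < 1` (Mathlib:
`riemannZeta_eq_zero_iff_of_re_nonpos`, `riemannZeta_ne_zero_of_one_le_re`).
[cite: BorweinFergusonMossinghoff2008, §1 (p. 1681)] -/
theorem simpleZeros_of_liouvilleSum_eventually_nonpos {x₁ : ℝ}
    (hL : ∀ x, x₁ ≤ x → liouvilleSum x ≤ 0) : SimpleZerosConjecture := by
  intro ρ hρ
  have hρ' : riemannZeta ρ = 0 ∧ ∀ n : ℕ, (-2 * (n + 1) : ℂ) ≠ ρ := by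
    simpa [RHWave0.riemannZetaNontrivialZeros, mem_riemannZetaZeros] using hρ
  obtain ⟨hζρ, hntriv⟩ := hρ'
  have h0 : 0 < ρ.re := by
    by_contra h0
    obtain ⟨n, hn⟩ := (riemannZeta_eq_zero_iff_of_re_nonpos (not_lt.1 h0)).1 hζρ
    exact hntriv n hn.symm
  have h1 : ρ.re < 1 := by
    by_contra h1
    exact riemannZeta_ne_zero_of_one_le_re (not_lt.1 h1) hζρ
  exact (zetaZeros_simple_onLine_of_liouvilleSum_eventually_nonpos hL ρ hζρ h0 h1).2

end Literature.NumberTheory.LFunctions
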